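/-
Copyright: the b2b-balaban T⁴-continuum CRUX team, row NE7b leaf lineage `t4-ne7b-formalise-leaf-03` (gen 151). Project licence.
-/
import Literature.MathematicalPhysics.QuantumFieldTheory.Balaban1983to89.B4Green244
import Literature.MathematicalPhysics.QuantumFieldTheory.Balaban1983to89.B5Momentum166Zd

/-!
# BESSEL'S INEQUALITY FOR LATTICE KERNELS ON THE BRILLOUIN ZONE: for a multiplier `G` continuous on `[−π,π]^d` and every
# FINITE set `S ⊂ ℤ^d` of lattice points, `Σ_{x∈S} |(2π)^{−d}∫ G(p)e^{ip·x}dp|² ≤ (2π)^{−d}∫ |G(p)|² dp`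
# (row NE7b, node U5c; the EASY direction of Parseval — no completeness of the characters is used; [folklore])

Cell `pub-balaban`, sub-cell `t4`, spine estimate NE7b (`T4WeightBudget.RelWeightBound`; the cell's OWN estimate — NOT PRINTED in
[Bałaban 1983–89], NOT PROVED).  Crux-route work under `Spine/NE7b/` by leaf-03 (CRUX team (2), FREEZE (0) crux-prover clause):
the analytic half of the PLANCHEREL JUNCTION of the owner's one-shot chart letter (RULING W-ne7bp1-g111-3 (d), CLAIM C-ne7bp1-g111-1;
leaf-03 FILING-CLAIM C-leaf03-g151-OSCP).  NOTHING of Bałaban's is named, asserted, valued or discharged; no `T4Continuum/Support`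
leaf typed; no `def`; zero `sorry`.  Imports: the tree's Literature modules `B4Green244` (the lattice-kernel calculus on the zone:
`latticeKernel`, `fourierBox`, `fourierBox_one`) and `B5Momentum166Zd` (the zone `BZ d = [−π,π]^d` is compact and measurable) — used
BY NAME for [folklore] objects only (no printed statement of [B4]/[B5] enters).

WHAT IS PROVED ([folklore]; `G : (Fin d → ℂ) → ℂ` a multiplier read on the real zone through `ofRealVec`, `S : Finset (Fin d → ℤ)`):
* §1 bookkeeping on the characters `e^{ip·x}`: conjugation flips the sign of the phase, products add lattice points, and the zone
  integral of `G(p)e^{ip·x}` is `(2π)^d` times the lattice kernel `latticeKernel G x`.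
* §2 the two Gram identities of the trigonometric polynomial `P(p) = Σ_{x∈S} c_x e^{−ip·x}` with `c_x = latticeKernel G x`:
  `∫ G·conj P = (2π)^d Σ_{x∈S} |c_x|²` (`integral_mul_conj_trigPoly`) and `∫ P·conj P = (2π)^d Σ_{x∈S} |c_x|²`
  (`integral_trigPoly_mul_conj`), from the orthogonality `∫_{[−π,π]^d} e^{ip·y}dp = (2π)^d δ_{y,0}` (`B4Green244.fourierBox_one`).
* §3 **`sum_norm_latticeKernel_sq_le`** — BESSEL: `Σ_{x∈S} ‖latticeKernel G x‖² ≤ (2π)^{−d} ∫_{[−π,π]^d} ‖G(p)‖² dp` whenever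
  `p ↦ G(p)` is continuous on the zone: `0 ≤ ∫‖G − P‖² = ∫‖G‖² − (2π)^d Σ_{x∈S}|c_x|²`.

NOT HERE (honest): Parseval's identity / completeness of the characters (the reverse inequality for the full `tsum`), `L²` multipliers,
anything of Bałaban's.  This is the inequality through which the fibre bound of `OneShotChartFibreBound` (owner, (39)) becomes a bound
on FINITE WINDOWS of the fine lattice for the Bloch candidate of the one-shot critical section (leaf-03's companion files); the
PLANCHEREL IDENTITY `M^{−d}‖H_M B‖² = ∫(S₂∕S²)|B̂|²` itself is NOT claimed.  BY-NAME EFFECT ON THE WALL: NONE.  NE7b NOT PRINTED ∕ NOT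
PROVED; spine PROVED 0∕9; rung (B)+1 on a FINITE torus — NOT infinite volume, NOT the mass gap, NOT Clay.  HONEST DEPENDENCY: continuum
YM on T⁴ ⇐ BetaPertH ∧ nine spine estimates (0∕9 proved); BetaPertH ⇐ (D1) ∧ (D4) ∧ CAP+tail; G-an2-4 gates asym, D1 and NE2∕3∕4.
-/

set_option autoImplicit false

namespace Summit.QuantumFields.BalabanUV.T4Continuum.NE7b.LatticeBesselInequality

open MeasureTheory Complex Finset
open Literature.MathematicalPhysics.QuantumFieldTheory.Balaban1983to89
open B4Strip (ofRealVec)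
open B4ContourShift (BZ phase integrand fourierBox latticeKernel phase_eq_ofReal norm_cexp_phase continuous_ofRealVec)
open B4Green244 (phase_add fourierBox_one)
open B5Momentum166Zd (isCompact_BZ measurableSet_BZ)
open scoped Real ComplexConjugate

noncomputable section

variable {d : ℕ}

/-! ## §1. Characters on the zone -/

/-- The phase `p·x` is a real number. [folklore] -/
theorem conj_phase (p : Fin d → ℝ) (x : Fin d → ℤ) : conj (phase p x) = phase p x := by
  rw [phase_eq_ofReal, Complex.conj_ofReal]

/-- `conj e^{ip·x} = e^{−ip·x}`. [folklore] -/
theorem conj_cexp_phase (p : Fin d → ℝ) (x : Fin d → ℤ) :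
    conj (cexp (I * phase p x)) = cexp (-(I * phase p x)) := by
  rw [← Complex.exp_conj, map_mul, Complex.conj_I, conj_phase, neg_mul]

/-- `conj e^{−ip·x} = e^{ip·x}`. [folklore] -/
theorem conj_cexp_neg_phase (p : Fin d → ℝ) (x : Fin d → ℤ) :
    conj (cexp (-(I * phase p x))) = cexp (I * phase p x) := by
  rw [← Complex.exp_conj, map_neg, map_mul, Complex.conj_I, conj_phase, neg_mul, neg_neg]

/-- `p·(x − y) = p·x − p·y`. [folklore] -/
theorem phase_sub (p : Fin d → ℝ) (x y : Fin d → ℤ) : phase p (x - y) = phase p x - phase p y := by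
  have h := phase_add p (x - y) y
  rw [sub_add_cancel] at h
  rw [h]; ring

/-- `e^{−ip·x} e^{ip·x′} = e^{ip·(x′ − x)}`. [folklore] -/
theorem cexp_neg_phase_mul_cexp_phase (p : Fin d → ℝ) (x x' : Fin d → ℤ) :
    cexp (-(I * phase p x)) * cexp (I * phase p x') = cexp (I * phase p (x' - x)) := by
  rw [← Complex.exp_add, phase_sub]
  ring_nf

/-- `p ↦ e^{ip·x}` is continuous. [folklore] -/
theorem continuous_cexp_phase (x : Fin d → ℤ) : Continuous fun p : Fin d → ℝ => cexp (I * phase p x) := by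
  unfold phase; fun_prop

/-- `p ↦ e^{−ip·x}` is continuous. [folklore] -/
theorem continuous_cexp_neg_phase (x : Fin d → ℤ) : Continuous fun p : Fin d → ℝ => cexp (-(I * phase p x)) := by
  unfold phase; fun_prop

/-- The zone integral of `G(p)e^{ip·x}` is `(2π)^d` times the lattice kernel. [folklore] -/
theorem fourierBox_eq_smul_latticeKernel (G : (Fin d → ℂ) → ℂ) (x : Fin d → ℤ) :
    fourierBox G x = (((2 * π) ^ d : ℝ) : ℂ) * latticeKernel G x := by
  unfold latticeKernel
  rw [Complex.real_smul, ← mul_assoc]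
  push_cast
  rw [mul_inv_cancel₀ (pow_ne_zero _ (mul_ne_zero two_ne_zero (by exact_mod_cast Real.pi_ne_zero))), one_mul]

/-- `∫_{[−π,π]^d} e^{ip·y} dp = (2π)^d δ_{y,0}` (the orthogonality of the characters, `B4Green244.fourierBox_one`). [folklore] -/
theorem integral_cexp_phase (y : Fin d → ℤ) :
    ∫ p in BZ d, cexp (I * phase p y) = if y = 0 then (((2 * π) ^ d : ℝ) : ℂ) else 0 := by
  have h := fourierBox_one (d := d) y
  unfold fourierBox integrand at h
  simp only [one_mul] at h
  rw [h]
  push_cast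
  rfl

/-! ## §2. The two Gram identities of the truncated Fourier series -/

/-- A multiplier continuous on the zone has an integrable character-weighted integrand. [folklore] -/
theorem integrableOn_mul_cexp_phase {F : (Fin d → ℝ) → ℂ} (hF : ContinuousOn F (BZ d)) (x : Fin d → ℤ) :
    IntegrableOn (fun p => F p * cexp (I * phase p x)) (BZ d) :=
  (hF.mul (continuous_cexp_phase x).continuousOn).integrableOn_compact isCompact_BZ

/-- **`∫ G·conj P = (2π)^d Σ_{x∈S} |c_x|²`** for the trigonometric polynomial `P = Σ_{x∈S} c_x e^{−ip·x}` whose coefficients are the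
lattice kernel of `G`, `c_x = latticeKernel G x`. [folklore] -/
theorem integral_mul_conj_trigPoly (G : (Fin d → ℂ) → ℂ) (hG : ContinuousOn (fun p : Fin d → ℝ => G (ofRealVec p)) (BZ d))
    (S : Finset (Fin d → ℤ)) :
    ∫ p in BZ d, G (ofRealVec p) * conj (∑ x ∈ S, latticeKernel G x * cexp (-(I * phase p x)))
      = (((2 * π) ^ d : ℝ) : ℂ) * ∑ x ∈ S, (‖latticeKernel G x‖ ^ 2 : ℝ) := by
  have h1 : ∀ p : Fin d → ℝ, G (ofRealVec p) * conj (∑ x ∈ S, latticeKernel G x * cexp (-(I * phase p x)))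
      = ∑ x ∈ S, conj (latticeKernel G x) * (G (ofRealVec p) * cexp (I * phase p x)) := by
    intro p
    rw [map_sum, Finset.mul_sum]
    refine Finset.sum_congr rfl fun x _ => ?_
    rw [map_mul, conj_cexp_neg_phase]
    ring
  simp_rw [h1]
  rw [integral_finsetSum _ fun x _ => (integrableOn_mul_cexp_phase hG x).const_mul _]
  push_cast
  rw [Finset.mul_sum]
  refine Finset.sum_congr rfl fun x _ => ?_
  rw [integral_const_mul]
  have h2 : ∫ p in BZ d, G (ofRealVec p) * cexp (I * phase p x) = fourierBox G x := rfl
  rw [h2, fourierBox_eq_smul_latticeKernel, ← mul_assoc, mul_comm (conj _), mul_assoc, Complex.conj_mul']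
  push_cast; ring

/-- **`∫ P·conj P = (2π)^d Σ_{x∈S} |c_x|²`** for the same trigonometric polynomial. [folklore] -/
theorem integral_trigPoly_mul_conj (c : (Fin d → ℤ) → ℂ) (S : Finset (Fin d → ℤ)) :
    ∫ p in BZ d, (∑ x ∈ S, c x * cexp (-(I * phase p x))) * conj (∑ x ∈ S, c x * cexp (-(I * phase p x)))
      = (((2 * π) ^ d : ℝ) : ℂ) * ∑ x ∈ S, (‖c x‖ ^ 2 : ℝ) := by
  have h1 : ∀ p : Fin d → ℝ,
      (∑ x ∈ S, c x * cexp (-(I * phase p x))) * conj (∑ x ∈ S, c x * cexp (-(I * phase p x)))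
        = ∑ x ∈ S, ∑ x' ∈ S, (c x * conj (c x')) * cexp (I * phase p (x' - x)) := by
    intro p
    rw [map_sum, Finset.sum_mul_sum]
    refine Finset.sum_congr rfl fun x _ => Finset.sum_congr rfl fun x' _ => ?_
    rw [map_mul, conj_cexp_neg_phase, mul_mul_mul_comm, cexp_neg_phase_mul_cexp_phase]
  simp_rw [h1]
  have hint : ∀ x x' : Fin d → ℤ,
      IntegrableOn (fun p : Fin d → ℝ => (c x * conj (c x')) * cexp (I * phase p (x' - x))) (BZ d) := fun x x' =>
    ((continuous_cexp_phase (x' - x)).continuousOn.integrableOn_compact isCompact_BZ).const_mul _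
  rw [integral_finsetSum _ fun x _ => integrable_finsetSum _ fun x' _ => hint x x']
  push_cast
  rw [Finset.mul_sum]
  refine Finset.sum_congr rfl fun x hx => ?_
  rw [integral_finsetSum _ fun x' _ => hint x x']
  simp_rw [integral_const_mul, integral_cexp_phase, sub_eq_zero, mul_ite, mul_zero]
  rw [Finset.sum_ite_eq' S x, if_pos hx, Complex.mul_conj']
  push_cast; ring

/-! ## §3. Bessel's inequality -/

/-- **BESSEL'S INEQUALITY FOR LATTICE KERNELS.**  For a multiplier `G` continuous on the zone `[−π,π]^d` and every finite set `S`
of lattice points, `Σ_{x∈S} ‖(2π)^{−d}∫_{[−π,π]^d} G(p)e^{ip·x}dp‖² ≤ (2π)^{−d}∫_{[−π,π]^d} ‖G(p)‖² dp`.  Proof: with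
`c_x = latticeKernel G x` and `P = Σ_{x∈S} c_x e^{−ip·x}`, `0 ≤ ∫‖G − P‖² = ∫‖G‖² − (2π)^dΣ_{x∈S}|c_x|²` by §2. [folklore] -/
theorem sum_norm_latticeKernel_sq_le (G : (Fin d → ℂ) → ℂ) (hG : ContinuousOn (fun p : Fin d → ℝ => G (ofRealVec p)) (BZ d))
    (S : Finset (Fin d → ℤ)) :
    ∑ x ∈ S, ‖latticeKernel G x‖ ^ 2 ≤ ((2 * π) ^ d)⁻¹ * ∫ p in BZ d, ‖G (ofRealVec p)‖ ^ 2 := by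
  -- the trigonometric polynomial and its continuity
  set P : (Fin d → ℝ) → ℂ := fun p => ∑ x ∈ S, latticeKernel G x * cexp (-(I * phase p x)) with hP
  have hPc : Continuous P := by
    rw [hP]; exact continuous_finsetSum _ fun x _ => continuous_const.mul (continuous_cexp_neg_phase x)
  set s : ℝ := ∑ x ∈ S, ‖latticeKernel G x‖ ^ 2 with hs
  have hπd : (0 : ℝ) < (2 * π) ^ d := by positivity
  -- the four pieces of `∫ (G − P)·conj(G − P)`
  have hGG : IntegrableOn (fun p : Fin d → ℝ => G (ofRealVec p) * conj (G (ofRealVec p))) (BZ d) :=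
    (hG.mul (Complex.continuous_conj.comp_continuousOn hG)).integrableOn_compact isCompact_BZ
  have hGP : IntegrableOn (fun p : Fin d → ℝ => G (ofRealVec p) * conj (P p)) (BZ d) :=
    (hG.mul (Complex.continuous_conj.comp hPc).continuousOn).integrableOn_compact isCompact_BZ
  have hPG : IntegrableOn (fun p : Fin d → ℝ => P p * conj (G (ofRealVec p))) (BZ d) :=
    (hPc.continuousOn.mul (Complex.continuous_conj.comp_continuousOn hG)).integrableOn_compact isCompact_BZ
  have hPP : IntegrableOn (fun p : Fin d → ℝ => P p * conj (P p)) (BZ d) :=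
    (hPc.mul (Complex.continuous_conj.comp hPc)).continuousOn.integrableOn_compact isCompact_BZ
  -- their values
  have vGG : ∫ p in BZ d, G (ofRealVec p) * conj (G (ofRealVec p))
      = ((∫ p in BZ d, ‖G (ofRealVec p)‖ ^ 2 : ℝ) : ℂ) := by
    rw [← integral_complex_ofReal]
    exact integral_congr_ae (Filter.Eventually.of_forall fun p => by
      simp only [Complex.mul_conj']; push_cast; ring)
  have vGP : ∫ p in BZ d, G (ofRealVec p) * conj (P p) = (((2 * π) ^ d : ℝ) : ℂ) * (s : ℂ) := by
    rw [hs]; push_cast; rw [hP]; exact (integral_mul_conj_trigPoly G hG S).trans (by push_cast; rfl)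
  have vPG : ∫ p in BZ d, P p * conj (G (ofRealVec p)) = (((2 * π) ^ d : ℝ) : ℂ) * (s : ℂ) := by
    have h : (fun p : Fin d → ℝ => P p * conj (G (ofRealVec p)))
        = fun p => conj (G (ofRealVec p) * conj (P p)) := by
      funext p; rw [map_mul, Complex.conj_conj, mul_comm]
    rw [h, integral_conj, vGP, map_mul, Complex.conj_ofReal, Complex.conj_ofReal]
  have vPP : ∫ p in BZ d, P p * conj (P p) = (((2 * π) ^ d : ℝ) : ℂ) * (s : ℂ) := by
    rw [hs]; push_cast; rw [hP]; exact (integral_trigPoly_mul_conj (latticeKernel G) S).trans (by push_cast; rfl)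
  -- `∫‖G − P‖²` as a real number, nonnegative
  have hdiff : IntegrableOn (fun p : Fin d → ℝ => ‖G (ofRealVec p) - P p‖ ^ 2) (BZ d) :=
    ((hG.sub hPc.continuousOn).norm.pow 2).integrableOn_compact isCompact_BZ
  have hnn : 0 ≤ ∫ p in BZ d, ‖G (ofRealVec p) - P p‖ ^ 2 := integral_nonneg fun p => by positivity
  -- expansion
  have hexp : ((∫ p in BZ d, ‖G (ofRealVec p) - P p‖ ^ 2 : ℝ) : ℂ)
      = ((∫ p in BZ d, ‖G (ofRealVec p)‖ ^ 2 : ℝ) : ℂ) - (((2 * π) ^ d : ℝ) : ℂ) * (s : ℂ) := by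
    rw [← integral_complex_ofReal]
    have h1 : (fun p : Fin d → ℝ => ((‖G (ofRealVec p) - P p‖ ^ 2 : ℝ) : ℂ))
        = fun p => (G (ofRealVec p) * conj (G (ofRealVec p)) - G (ofRealVec p) * conj (P p))
            - (P p * conj (G (ofRealVec p)) - P p * conj (P p)) := by
      funext p
      push_cast
      rw [← Complex.mul_conj', map_sub]
      ring
    rw [h1, integral_sub (f := fun p => G (ofRealVec p) * conj (G (ofRealVec p)) - G (ofRealVec p) * conj (P p))
      (g := fun p => P p * conj (G (ofRealVec p)) - P p * conj (P p)) (hGG.sub hGP) (hPG.sub hPP),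
      integral_sub hGG hGP, integral_sub hPG hPP, vGG, vGP, vPG, vPP]
    ring
  have hre := congrArg Complex.re hexp
  simp only [Complex.ofReal_re, Complex.sub_re, Complex.mul_re, Complex.ofReal_im, mul_zero, sub_zero] at hre
  -- conclude
  rw [le_inv_mul_iff₀ hπd]
  linarith

end

end Summit.QuantumFields.BalabanUV.T4Continuum.NE7b.LatticeBesselInequality
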